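import Literature.Barriers.CriticalPhenomena.GridSAWCountingGridHamPathHardness
import Literature.Barriers.CriticalPhenomena.GridSAWCountingGridHamPathHardnessProofs
import Literature.Computability.Complexity.ParsimoniousThreeCNFMachine
import HarnessLib

/-!
# Discharges of named facts of `GridSAWCountingViaGridHamPath.lean`

`Literature/Barriers/CriticalPhenomena/GridSAWCountingViaGridHamPathHolds.lean` — proofs-only
sibling of `GridSAWCountingViaGridHamPath.lean` (no definitions, no named facts). Each theorem
below closes a named fact `X : Prop` of that file as `X_holds : X` by composing an ACCEPTED
reduction theorem of the tree with the ACCEPTED unconditional `_holds` discharges of all of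
its hypotheses; nothing is re-proved and no statement is changed. Recorded by the librarian
sweep g25 (2026-08-16, pass 5c: facts dischargeable in one line from the tree's own lemmas),
so that the facts census, `#h21_route_deps` and the cone guardrail see these facts as
theorems.

Discharged here:

* `LOT2003_lemma4_grid_holds` := `LOT2003_lemma4_grid_of_gadgets`
  `LOT2003_prop2_sharp3SAT_holds` `LOT2003_lemma4_gadgets_holds`
  (`GridSAWCountingGridHamPathHardness.lean`).

## References

* [LiskiewiczOgiharaToda2003] — see `lean/references.bib` and the docstring of the fact in `GridSAWCountingViaGridHamPath.lean`.
-/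

namespace Literature.Barriers.CriticalPhenomena.GridSAW

/-- **Discharge of the named fact `LOT2003_lemma4_grid`** (`GridSAWCountingViaGridHamPath.lean`):
Lemma 4 composed with the embedding step of the proof of Theorem 7: every `#P` function is
`≤ᵖ_{r-shift}`-reducible to `#HamPath` on graphs of maximum degree three presented with a
congestion-free grid drawing (`GRIDHAMPATHCOUNT`). In print: … — obtained as
`LOT2003_lemma4_grid_of_gadgets` applied to the tree's unconditional discharges
`LOT2003_prop2_sharp3SAT_holds`, `LOT2003_lemma4_gadgets_holds` of its hypotheses (reduction
in `GridSAWCountingGridHamPathHardness.lean`).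
[cite: LiskiewiczOgiharaToda2003, Lemma 4 and §4, proof of Theorem 7 (construction of E₀)] -/
theorem LOT2003_lemma4_grid_holds :
    LOT2003_lemma4_grid :=
  LOT2003_lemma4_grid_of_gadgets
    Literature.Computability.Complexity.LOT2003_prop2_sharp3SAT_holds
    LOT2003_lemma4_gadgets_holds

end Literature.Barriers.CriticalPhenomena.GridSAW
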